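import Summits.ResolutionOfSingularities.ResolutionOfSingularities.Theorems.FrobeniusClosingPatchingRelPerfectDepthParamLiftChartInputs
import Summits.ResolutionOfSingularities.ResolutionOfSingularities.Theorems.FrobeniusClosingPatchingRelPerfectDepthParamLiftChartQuotient
import Summits.ResolutionOfSingularities.ResolutionOfSingularities.Theorems.FrobeniusClosingPatchingRelPerfectDepthParamLiftPolynomialCharts
import Summits.ResolutionOfSingularities.ResolutionOfSingularities.Theorems.FrobeniusClosingPatchingRelPerfectDepthParamLiftQuotient
import Summits.ResolutionOfSingularities.ResolutionOfSingularities.Theorems.FrobeniusClosingPatchingRelPerfectDepthParamLiftSection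
import HarnessLib

/-!
# Crux `PatchingRelPerfect` (stmt-ResolutionOfSingularities-16161), chain W5.2 — F7(β) d = 2 (β-AX), X2a module 2 (M2c), e-chart step E5:
# PARAM-LIFT of the lifted retraction AT THE POINTS OVER THE CENTRE (`hchart`), hence everywhere (`hparam`)

[OURS · L1 W5.2 · F7(β) (β-AX) X-side · res-D-pv-034 AS res-L1-s36-pv-3 per res-L1-w52-plan-1 RULING G11-21 ((M2c) PARAM
PROPAGATION).]  Replaces the role of NO printed item; NOT a statement of the manuscript under review; fact-free, def-free.
AI-written; AI review is weaker than expert review.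

At a point `y′` of the lifted cylinder region over the pushed centre: the two stalk presentations (`…ChartInputs`), their quotients
by the matched exceptional parameter as localised polynomial charts over `A/𝔞 ≅ B_X/𝔟` (`…ChartQuotient`, SECTION ISO
`…ParamLiftSection`), ALGEBRA III (`…PolynomialCharts`) for the induced map, ALGEBRA I (`…ParamLiftQuotient`) to lift through the
parameter, transport along `ι_{V′}^♯`: **`IsParamLiftAt r′ y′`**.  With `…ParamLiftStep` this discharges the `hparam` hypothesis of
res-D-pv-054's `CylState.lift_of` for every blowing up whose transformed families are snc (`HasSNC` on `Z′` containing `E_{Z′}`, on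
`X′` containing `E_{X′}` — the outputs of `HasSNCWith.hasSNC_transform`).

* **`CylState.isParamLiftAt_lift_of_mem_centre`** (the e-chart), **`CylState.isParamLiftAt_lift`** (`hparam`).

## References
* H. Matsumura, *Commutative Ring Theory* (1986), Thm. 14.2, Thm. 23.7. [Matsumura1987]
* U. Görtz, T. Wedhorn, *Algebraic Geometry I* (2020), (13.19), Prop. 13.91. [GortzWedhorn2020]
-/

-- `Summit.<Summit>.<Sub>.Theorems` with `Sub = Summit` (single-conjunct summit, D-0017)
set_option linter.dupNamespace false

noncomputable section

open CategoryTheory AlgebraicGeometry TopologicalSpace IsLocalRing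
open Literature.AlgebraicGeometry.Resolution
open Scheme.IdealSheafData

namespace Summit.ResolutionOfSingularities.ResolutionOfSingularities.Theorems.DepthMultiHost

universe u

/-! ## §1 Small algebra -/

section Algebra

/-- A quotient by a principal ideal generated by a member of a regular system of parameters is regular. [cite: Matsumura1987, Thm. 14.2] -/
theorem isRegularLocalRing_quotient_of_rsop_member {R : Type u} [CommRing R] [IsLocalRing R] {n : ℕ} {v : Fin n → R}
    (hv : IsRsopPart v) (i : Fin n) {I : Ideal R} (hI : I = Ideal.span {v i}) : IsRegularLocalRing (R ⧸ I) := by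
  have h := (hv.comp (fun _ : Fin 1 => i) (fun a b _ => Subsingleton.elim a b)).isRegularLocalRing_quotient
  have hrange : Set.range (v ∘ fun _ : Fin 1 => i) = {v i} := by
    ext x; simp [eq_comm]
  rw [hrange, ← hI] at h
  exact h

/-- The quotient map of a local homomorphism between local rings is local. [folklore] -/
theorem isLocalHom_quotientMap {S T : Type u} [CommRing S] [CommRing T] [IsLocalRing S] [IsLocalRing T] (f : S →+* T)
    [IsLocalHom f] {I : Ideal S} {J : Ideal T} (hIJ : I ≤ J.comap f)
    [IsLocalRing (S ⧸ I)] [IsLocalRing (T ⧸ J)] : IsLocalHom (Ideal.quotientMap J f hIJ) := by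
  refine ⟨fun x hx => ?_⟩
  obtain ⟨s, rfl⟩ := Ideal.Quotient.mk_surjective x
  rw [Ideal.quotientMap_mk] at hx
  haveI := IsLocalHom.of_surjective (Ideal.Quotient.mk J) Ideal.Quotient.mk_surjective
  have h1 : IsUnit (f s) := isUnit_of_map_unit (Ideal.Quotient.mk J) _ hx
  exact (Ideal.Quotient.mk I).isUnit_map (isUnit_of_map_unit f s h1)

set_option maxHeartbeats 800000 in -- two `blowupAlgebra` chart algebras and their quotient charts (cf. p537631: 400000 for one)
/-- [OURS · L1 W5.2 · F7(β) (β-AX) M2c, E-CHART RING CORE] **PARAM-LIFT data from the chart data.**  Abstract form of the e-chart: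
`SA = A[𝔞/a_l]_{𝔔A}`, `SX = B[𝔟/c_{l+1}]_{𝔔B}` regular local, `ψ` the chart map over `σ : A → B` (`c_{i+1} = σ a_i`),
`f : SA → SX` local with `χB ∘ ψ = f ∘ χA`, `κ : A/𝔞 ≅ B/𝔟` over `σ`, the exceptional generators `gA = χA(a_l) ≠ 0`,
`gB = χB(c_{l+1})` regular with regular quotients: then `𝔪_{SA} SX ⊔ (s) = 𝔪_{SX}` with `#s + emb dim SA = emb dim SX`.
[cite: Matsumura1987, Thm. 23.7] -/
theorem exists_finset_sup_span_eq_maximalIdeal_of_chartData {A Bx SA SX : Type u} [CommRing A] [IsLocalRing A] [CommRing Bx]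
    [IsLocalRing Bx] [CommRing SA] [IsRegularLocalRing SA] [CommRing SX] [IsRegularLocalRing SX]
    {c : ℕ} (a : Fin c → A) (ha : IsRsopPart a) (l : Fin c) (cX : Fin (c + 1) → Bx) (hcX : IsRsopPart cX)
    (σx : A →+* Bx) (hσx : ∀ i, cX (Fin.succ i) = σx (a i))
    (κ : A ⧸ Ideal.span (Set.range a) ≃+* Bx ⧸ Ideal.span (Set.range cX))
    (hκ : ∀ r, κ (Ideal.Quotient.mk _ r) = Ideal.Quotient.mk _ (σx r))
    (χA : blowupAlgebra (Ideal.span (Set.range a)) (a l) →+* SA)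
    (𝔔A : PrimeSpectrum (blowupAlgebra (Ideal.span (Set.range a)) (a l)))
    (hlocA : @IsLocalization.AtPrime _ _ SA _ χA.toAlgebra 𝔔A.asIdeal _)
    (h𝔔A : 𝔔A.asIdeal.comap (algebraMap A (blowupAlgebra (Ideal.span (Set.range a)) (a l))) = maximalIdeal A)
    (χB : blowupAlgebra (Ideal.span (Set.range cX)) (cX l.succ) →+* SX)
    (𝔔B : PrimeSpectrum (blowupAlgebra (Ideal.span (Set.range cX)) (cX l.succ)))
    (hlocB : @IsLocalization.AtPrime _ _ SX _ χB.toAlgebra 𝔔B.asIdeal _)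
    (h𝔔B : 𝔔B.asIdeal.comap (algebraMap Bx (blowupAlgebra (Ideal.span (Set.range cX)) (cX l.succ))) = maximalIdeal Bx)
    (ψ : blowupAlgebra (Ideal.span (Set.range a)) (a l) →+* blowupAlgebra (Ideal.span (Set.range cX)) (cX l.succ))
    (hψalg : ∀ x, ψ (algebraMap _ _ x) = algebraMap _ _ (σx x))
    (f' : SA →+* SX) [IsLocalHom f'] (hcomp : χB.comp ψ = f'.comp χA)
    {gA : SA} (hgA : χA (algebraMap _ _ (a l)) = gA) (hgA0 : gA ≠ 0) (hgAm : gA ∈ maximalIdeal SA)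
    {gB : SX} (hgB : χB (algebraMap _ _ (cX l.succ)) = gB) (hgBnzd : gB ∈ nonZeroDivisors SX)
    [IsRegularLocalRing (SA ⧸ Ideal.span {gA})] [IsRegularLocalRing (SX ⧸ Ideal.span {gB})] :
    ∃ s : Finset SX, (maximalIdeal SA).map f' ⊔ Ideal.span (s : Set SX) = maximalIdeal SX ∧
      s.card + (maximalIdeal SA).spanFinrank = (maximalIdeal SX).spanFinrank := by
  classical
  haveI := ha.isRegularLocalRing_quotient
  haveI := hcX.isRegularLocalRing_quotient
  -- `f gA = gB`
  have hψl : ψ (algebraMap _ _ (a l)) = algebraMap _ _ (cX l.succ) := by rw [hψalg, hσx]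
  have hfgA : f' gA = gB := by
    have h := RingHom.congr_fun hcomp (algebraMap _ _ (a l))
    simp only [RingHom.comp_apply] at h
    rw [hψl, hgB, hgA] at h
    exact h.symm
  have hgBm : gB ∈ maximalIdeal SX := by rw [← hfgA]; exact map_nonunit f' _ hgAm
  -- the two quotient charts
  obtain ⟨𝔓A, h𝔓A, algA, -, -, halgAC, halgAX, hlocA'⟩ :=
    exists_isLocalization_quotient_blowupAlgebra a ha l χA 𝔔A hlocA h𝔔A
  obtain ⟨𝔓B, h𝔓B, algB, -, -, halgBC, halgBX, hlocB'⟩ :=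
    exists_isLocalization_quotient_blowupAlgebra cX hcX l.succ χB 𝔔B hlocB h𝔔B
  have hJA : (Ideal.span {algebraMap _ (blowupAlgebra (Ideal.span (Set.range a)) (a l)) (a l)}).map χA = Ideal.span {gA} := by
    rw [Ideal.map_span, Set.image_singleton, hgA]
  have hJB : (Ideal.span {algebraMap _ (blowupAlgebra (Ideal.span (Set.range cX)) (cX l.succ)) (cX l.succ)}).map χB =
      Ideal.span {gB} := by
    rw [Ideal.map_span, Set.image_singleton, hgB]
  haveI hSAq' : IsRegularLocalRing (SA ⧸
      (Ideal.span {algebraMap _ (blowupAlgebra (Ideal.span (Set.range a)) (a l)) (a l)}).map χA) := by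
    rw [hJA]; infer_instance
  haveI hSXq' : IsRegularLocalRing (SX ⧸
      (Ideal.span {algebraMap _ (blowupAlgebra (Ideal.span (Set.range cX)) (cX l.succ)) (cX l.succ)}).map χB) := by
    rw [hJB]; infer_instance
  -- the induced map of the quotient charts
  have hle : (Ideal.span {algebraMap _ (blowupAlgebra (Ideal.span (Set.range a)) (a l)) (a l)}).map χA ≤
      ((Ideal.span {algebraMap _ (blowupAlgebra (Ideal.span (Set.range cX)) (cX l.succ)) (cX l.succ)}).map χB).comap f' := by
    rw [hJA, hJB, Ideal.span_singleton_le_iff_mem, Ideal.mem_comap, hfgA]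
    exact Ideal.mem_span_singleton_self _
  haveI : IsLocalHom (Ideal.quotientMap _ f' hle) := isLocalHom_quotientMap f' hle
  -- compatibility on generators
  have hC : ∀ r, Ideal.quotientMap _ f' hle (algA (MvPolynomial.C r)) = algB (MvPolynomial.C (κ r)) := by
    intro r
    obtain ⟨r, rfl⟩ := Ideal.Quotient.mk_surjective r
    rw [halgAC, hκ, halgBC, Ideal.quotientMap_mk]
    congr 1
    have h := RingHom.congr_fun hcomp (algebraMap _ _ r)
    simp only [RingHom.comp_apply] at h
    rw [← h, hψalg]
  have hXgen : ∀ mm : {mm : Fin c // mm ≠ l}, Ideal.quotientMap _ f' hle (algA (MvPolynomial.X mm)) =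
      algB (MvPolynomial.X ⟨mm.1.succ, fun h => mm.2 (Fin.succ_injective _ h)⟩) := by
    intro mm
    rw [halgAX, halgBX, Ideal.quotientMap_mk]
    congr 1
    have h := RingHom.congr_fun hcomp (blowupAlgebra.gen (Ideal.span (Set.range a)) (a l) (a mm.1)
      (Ideal.mem_span_range_self (f := a) (x := mm.1)))
    simp only [RingHom.comp_apply] at h
    rw [← h]
    refine (mul_cancel_right_mem_nonZeroDivisors hgBnzd).mp ?_
    have hgB' : gB = χB (ψ (algebraMap _ _ (a l))) := by rw [hψl, hgB]
    conv_lhs => rw [hgB', ← map_mul, ← map_mul, blowupAlgebra.gen_mul_algebraMap, hψalg, ← hσx]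
    rw [← hgB, ← map_mul, blowupAlgebra.gen_mul_algebraMap]
  -- ALGEBRA III on the quotient charts
  haveI := h𝔓A
  haveI := h𝔓B
  obtain ⟨sq, hsq1, hsq2⟩ :=
    exists_finset_sup_span_eq_maximalIdeal_of_polynomialCharts κ l 𝔓A algA hlocA' 𝔓B algB hlocB' _ hC hXgen
  -- transport to the principal-ideal quotients, then ALGEBRA I
  have hle₂ : Ideal.span {gA} ≤ (Ideal.span {f' gA}).comap f' := by
    rw [Ideal.span_singleton_le_iff_mem, Ideal.mem_comap]; exact Ideal.mem_span_singleton_self _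
  have hJB' : (Ideal.span {algebraMap _ (blowupAlgebra (Ideal.span (Set.range cX)) (cX l.succ)) (cX l.succ)}).map χB =
      Ideal.span {f' gA} := by rw [hJB, hfgA]
  haveI : IsRegularLocalRing (SX ⧸ Ideal.span {f' gA}) := by rw [hfgA]; infer_instance
  have hdata₂ := exists_finset_sup_span_eq_maximalIdeal_of_ringEquiv (Ideal.quotientMap _ f' hle)
    (Ideal.quotientMap _ f' hle₂) (Ideal.quotEquivOfEq hJA) (Ideal.quotEquivOfEq hJB') (fun x => by
      obtain ⟨x, rfl⟩ := Ideal.Quotient.mk_surjective x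
      rw [Ideal.quotientMap_mk, Ideal.quotEquivOfEq_mk, Ideal.quotEquivOfEq_mk, Ideal.quotientMap_mk]) ⟨sq, hsq1, hsq2⟩
  exact exists_finset_sup_span_eq_maximalIdeal_of_quotient f' hgAm hgA0 (by rw [hfgA]; exact nonZeroDivisors.ne_zero hgBnzd)
    hle₂ hdata₂

end Algebra

/-! ## §2 The e-chart -/

namespace CylState

variable {X : Scheme.{u}} {S : MultiHostState X} (cyl : CylState S)

section Chart

variable {X' Z' : Scheme.{u}} (C : cyl.Z.IdealSheafData) (𝓑 : List cyl.Z.IdealSheafData) (hsncZ : HasSNCWith 𝓑 C)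
  {τ : X' ⟶ X} (hτ : IsBlowup τ (vanishingIdeal (cyl.centre C)))
  {τZ : Z' ⟶ cyl.Z} (hτZ : IsBlowup τZ C) {V' : X'.Opens} (r' : (V' : Scheme.{u}) ⟶ Z')
  (φ : (V' : Scheme.{u}) ⟶ (cyl.V : Scheme.{u})) (hφ : φ ≫ cyl.V.ι = V'.ι ≫ τ) (hr'τ : r' ≫ τZ = φ ≫ cyl.q)
  (hexc : (C.comap τZ).comap r' = ((vanishingIdeal (cyl.centre C)).comap τ).comap V'.ι)
  (𝓔Z : List Z'.IdealSheafData) (hZ' : HasSNC 𝓔Z) (hCZ : C.comap τZ ∈ 𝓔Z)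
  (𝓔X : List X'.IdealSheafData) (hX' : HasSNC 𝓔X) (hWX : (vanishingIdeal (cyl.centre C)).comap τ ∈ 𝓔X)

include hsncZ hτ hτZ hφ hr'τ hexc hZ' hCZ hX' hWX in
set_option maxHeartbeats 800000 in -- two `blowupAlgebra` presentations (cf. p537631: 400000 for one)
/-- [OURS · L1 W5.2 · F7(β) (β-AX) M2c, THE E-CHART] **The lifted retraction lifts parameters at every point over the pushed centre.**
See the module docstring for the proof architecture. [cite: Matsumura1987, Thm. 23.7] [cite: GortzWedhorn2020, (13.19)] -/
theorem isParamLiftAt_lift_of_mem_centre (y' : (V' : Scheme.{u})) (hy : τ (V'.ι y') ∈ (cyl.centre C : Set X)) :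
    IsParamLiftAt r' y' := by
  classical
  -- §0 the point data
  have hyV : φ y' ∈ (cyl.j.ker.comap cyl.V.ι).support := by
    haveI := cyl.closedImmersion
    rw [support_comap]
    show cyl.V.ι (φ y') ∈ (cyl.j.ker.support : Set X)
    rw [Scheme.Hom.support_ker, cyl.j.isClosedEmbedding.isClosed_range.closure_eq, ← cyl.τ_ι_eq φ hφ y']
    exact cyl.centre_subset_range C hy
  have hqy : cyl.q (φ y') ∈ C.support := by
    obtain ⟨z, hz, hjz⟩ := (cyl.mem_centre_iff C _).mp hy
    have hyz : cyl.jV z = φ y' :=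
      cyl.V.ι.isOpenEmbedding.injective (by rw [cyl.V_ι_jV, hjz, cyl.τ_ι_eq φ hφ y'])
    rw [← hyz, cyl.q_jV]; exact hz
  -- generators `a` of `C_{q y}`: part of a regular system of parameters
  obtain ⟨m₀, u, hu, -, hCu⟩ := hsncZ.exists_isRsopPart_labels (cyl.q (φ y'))
  obtain ⟨T, hT⟩ := hCu hqy
  obtain ⟨k, ιT, hιT, hrange⟩ : ∃ (k : ℕ) (ιT : Fin k → Fin m₀), Function.Injective ιT ∧ Set.range ιT = T := by
    obtain ⟨k, ⟨e⟩⟩ := (Set.finite_coe_iff.mpr T.toFinite).exists_equiv_fin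
    exact ⟨k, fun i => (e.symm i).1, fun i j h => e.symm.injective (Subtype.ext h), by
      ext x; exact ⟨by rintro ⟨i, rfl⟩; exact (e.symm i).2, fun hx => ⟨e ⟨x, hx⟩, by simp⟩⟩⟩
  have ha : IsRsopPart (u ∘ ιT) := hu.comp ιT hιT
  have haspan : Ideal.span (Set.range (u ∘ ιT)) = stalkIdeal C (cyl.q (φ y')) := by
    rw [hT, Set.range_comp, hrange]
  -- §1 the presentations
  obtain ⟨l, t, cX, 𝔔A, χA, 𝔔B, χB, ψ, ht, hcXdef, -, hl1, hl2, hχA, hlocA, h𝔔A, hχB, hlocB, h𝔔B, hψalg, hcomp⟩ :=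
    cyl.exists_chartPresentation₂ C hτ hτZ r' φ hφ hr'τ hexc y' 𝓑 hsncZ hy (u ∘ ιT) haspan
  -- the rings and maps, named opaquely
  obtain ⟨ε, hε⟩ : ∃ ε : X.presheaf.stalk (cyl.V.ι (φ y')) ≃+* (cyl.V : Scheme.{u}).presheaf.stalk (φ y'),
      ε = (asIso (cyl.V.ι.stalkMap (φ y'))).commRingCatIsoToRingEquiv := ⟨_, rfl⟩
  obtain ⟨ε', hε'⟩ : ∃ ε' : X'.presheaf.stalk (V'.ι y') ≃+* (V' : Scheme.{u}).presheaf.stalk y',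
      ε' = (asIso (V'.ι.stalkMap y')).commRingCatIsoToRingEquiv := ⟨_, rfl⟩
  obtain ⟨ρ, hρ⟩ : ∃ ρ : cyl.Z.presheaf.stalk (cyl.q (φ y')) →+* Z'.presheaf.stalk (r' y'),
      ρ = ((cyl.Z.presheaf.stalkCongr (.of_eq (cyl.τZ_r_eq r' φ hr'τ y'))).inv ≫ τZ.stalkMap (r' y')).hom := ⟨_, rfl⟩
  obtain ⟨θ, hθ⟩ : ∃ θ : X.presheaf.stalk (cyl.V.ι (φ y')) →+* X'.presheaf.stalk (V'.ι y'),
      θ = ((X.presheaf.stalkCongr (.of_eq (cyl.τ_ι_eq φ hφ y'))).inv ≫ τ.stalkMap (V'.ι y')).hom := ⟨_, rfl⟩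
  rw [← hρ] at hχA hl2
  rw [← hθ] at hχB hl1
  rw [← hε] at hcXdef hψalg
  rw [← hε'] at hcomp
  have hcXsucc : ∀ i, cX (Fin.succ i) = (ε.symm.toRingHom.comp (cyl.q.stalkMap (φ y')).hom) ((u ∘ ιT) i) := fun i => by
    rw [hcXdef]
    show ε.symm ((Fin.cons t (fun i => (cyl.q.stalkMap (φ y')).hom ((u ∘ ιT) i)) : Fin (k + 1) → _) (Fin.succ i)) = _
    rw [Fin.cons_succ]
    rfl
  -- §2 regularity, locality, the exceptional generators
  haveI hSA : IsRegularLocalRing (Z'.presheaf.stalk (r' y')) := (hZ' (r' y')).1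
  haveI hSX : IsRegularLocalRing (X'.presheaf.stalk (V'.ι y')) := (hX' (V'.ι y')).1
  haveI hρloc : IsLocalHom ρ := by rw [hρ]; infer_instance
  haveI hf'loc : IsLocalHom (ε'.symm.toRingHom.comp (r'.stalkMap y').hom) :=
    ⟨fun x hx => isUnit_of_map_unit (r'.stalkMap y').hom x ((MulEquiv.isUnit_map ε'.symm.toMulEquiv).mp hx)⟩
  have hcX : IsRsopPart cX := by
    rw [hcXdef]
    exact isRsopPart_comp_ringEquiv ε.symm (cyl.isRsopPart_cons_carrier (φ y') hyV ht ha)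
  have hgA_nzd : ρ ((u ∘ ιT) l) ∈ nonZeroDivisors _ := by
    obtain ⟨g, hg, hIg⟩ := hτZ.isEffectiveCartier.exists_stalkIdeal_eq_span (r' y')
    exact mem_nonZeroDivisors_of_span_singleton_eq (hl2.symm.trans hIg) hg
  have hgB_nzd : θ (cX l.succ) ∈ nonZeroDivisors _ := by
    obtain ⟨g, hg, hIg⟩ := hτ.isEffectiveCartier.exists_stalkIdeal_eq_span (V'.ι y')
    exact mem_nonZeroDivisors_of_span_singleton_eq (hl1.symm.trans hIg) hg
  have hgAm : ρ ((u ∘ ιT) l) ∈ maximalIdeal _ := map_nonunit ρ _ (ha.mem_maximalIdeal l)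
  have hgBm : θ (cX l.succ) ∈ maximalIdeal _ := by
    by_contra hunit
    have h1 : stalkIdeal ((vanishingIdeal (cyl.centre C)).comap τ) (V'.ι y') = ⊤ := by
      rw [hl1, Ideal.span_singleton_eq_top]; exact (IsLocalRing.notMem_maximalIdeal).mp hunit
    have hmem : V'.ι y' ∈ (((vanishingIdeal (cyl.centre C)).comap τ)).support := by
      rw [support_comap]; exact hy
    rw [mem_support_iff_stalkIdeal_le, h1, top_le_iff] at hmem
    exact (maximalIdeal.isMaximal _).ne_top hmem
  -- regularity of the quotients: the exceptional divisors are snc members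
  haveI hSAq : IsRegularLocalRing (Z'.presheaf.stalk (r' y') ⧸ Ideal.span {ρ ((u ∘ ιT) l)}) := by
    obtain ⟨-, v, hv, ⟨lab, -, hlab⟩, -⟩ := hZ' (r' y')
    have hmem : r' y' ∈ (C.comap τZ).support := by
      rw [mem_support_iff_stalkIdeal_le, hl2, Ideal.span_singleton_le_iff_mem]; exact hgAm
    have hvr : IsRsopPart (v ∘ id) := isRsopPart_comp_of_rsop rfl v hv id Function.injective_id
    exact isRegularLocalRing_quotient_of_rsop_member hvr (lab ⟨_, hCZ, hmem⟩) (hl2.symm.trans (hlab ⟨_, hCZ, hmem⟩))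
  haveI hSXq : IsRegularLocalRing (X'.presheaf.stalk (V'.ι y') ⧸ Ideal.span {θ (cX l.succ)}) := by
    obtain ⟨-, v, hv, ⟨lab, -, hlab⟩, -⟩ := hX' (V'.ι y')
    have hmem : V'.ι y' ∈ ((vanishingIdeal (cyl.centre C)).comap τ).support := by
      rw [mem_support_iff_stalkIdeal_le, hl1, Ideal.span_singleton_le_iff_mem]; exact hgBm
    have hvr : IsRsopPart (v ∘ id) := isRsopPart_comp_of_rsop rfl v hv id Function.injective_id
    exact isRegularLocalRing_quotient_of_rsop_member hvr (lab ⟨_, hWX, hmem⟩) (hl1.symm.trans (hlab ⟨_, hWX, hmem⟩))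
  -- §3 the coefficient identification `κ : A/𝔞 ≅ B_X/𝔟` (SECTION ISO)
  obtain ⟨t₁, -, hst₁, hsec⟩ := cyl.exists_sectionIso (φ y') hyV
  obtain ⟨e₁, he₁⟩ := hsec (Ideal.span (Set.range (u ∘ ιT)))
  have ht₁ : Ideal.span {t₁} ⊔ (Ideal.span (Set.range (u ∘ ιT))).map (cyl.q.stalkMap (φ y')).hom =
      Ideal.span {t} ⊔ (Ideal.span (Set.range (u ∘ ιT))).map (cyl.q.stalkMap (φ y')).hom := by rw [← hst₁, ht]
  have hcXspan' : Ideal.span (Set.range cX) =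
      (Ideal.span {t} ⊔ (Ideal.span (Set.range (u ∘ ιT))).map (cyl.q.stalkMap (φ y')).hom).map (ε.symm : _ →+* _) := by
    rw [hcXdef]
    have h1 : (Set.range fun m => ε.symm ((Fin.cons t (fun i => (cyl.q.stalkMap (φ y')).hom ((u ∘ ιT) i)) :
        Fin (k + 1) → _) m)) = (ε.symm : _ →+* _) '' Set.range (Fin.cons t (fun i => (cyl.q.stalkMap (φ y')).hom ((u ∘ ιT) i)) :
        Fin (k + 1) → _) := by
      rw [← Set.range_comp]; rfl
    rw [h1, ← Ideal.map_span, Fin.range_cons, Ideal.span_insert, Ideal.map_span _ (Set.range _), ← Set.range_comp]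
    rfl
  have hκ : ∀ r, (e₁.trans ((Ideal.quotEquivOfEq ht₁).trans (Ideal.quotientEquiv _ _ ε.symm hcXspan'))) (Ideal.Quotient.mk _ r) =
      Ideal.Quotient.mk _ ((ε.symm.toRingHom.comp (cyl.q.stalkMap (φ y')).hom) r) := fun r => by
    rw [RingEquiv.trans_apply, RingEquiv.trans_apply, he₁, Ideal.quotEquivOfEq_mk, Ideal.quotientEquiv_mk]
    rfl
  -- §4 the ring core
  obtain ⟨s', hs'1, hs'2⟩ := exists_finset_sup_span_eq_maximalIdeal_of_chartData (u ∘ ιT) ha l cX hcX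
    (ε.symm.toRingHom.comp (cyl.q.stalkMap (φ y')).hom) hcXsucc _ hκ χA 𝔔A hlocA h𝔔A χB 𝔔B hlocB h𝔔B ψ hψalg
    (ε'.symm.toRingHom.comp (r'.stalkMap y').hom) hcomp (hχA ((u ∘ ιT) l))
    (nonZeroDivisors.ne_zero hgA_nzd) hgAm (hχB (cX l.succ)) hgB_nzd
  -- §5 transport along `ι_{V′}^♯`
  refine exists_finset_sup_span_eq_maximalIdeal_of_ringEquiv (ε'.symm.toRingHom.comp (r'.stalkMap y').hom) _
    (RingEquiv.refl _) ε' (fun x => ?_) ⟨s', hs'1, hs'2⟩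
  rw [RingEquiv.refl_apply, RingHom.comp_apply]
  exact ε'.apply_symm_apply _

include hsncZ hτ hτZ hφ hr'τ hexc hZ' hCZ hX' hWX in
/-- [OURS · L1 W5.2 · F7(β) (β-AX) M2c] **`hparam` DISCHARGED**: the lifted retraction of a cylinder state lifts parameters at EVERY
point of the lifted cylinder region (off the centre `…ParamLiftStep`, over it the e-chart above), for every blowing up whose
transformed families on `Z′` and `X′` are snc and contain the exceptional divisors. [cite: Matsumura1987, Thm. 23.7] -/
theorem isParamLiftAt_lift (y' : (V' : Scheme.{u})) : IsParamLiftAt r' y' :=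
  cyl.isParamLiftAt_lift_of_forall_mem_centre C hτ hτZ r' φ hφ hr'τ hexc
    (fun y'' hy'' => cyl.isParamLiftAt_lift_of_mem_centre C 𝓑 hsncZ hτ hτZ r' φ hφ hr'τ hexc 𝓔Z hZ' hCZ 𝓔X hX' hWX y'' hy'') y'

end Chart

end CylState

end Summit.ResolutionOfSingularities.ResolutionOfSingularities.Theorems.DepthMultiHost

end
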